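import Summits.BirchSwinnertonDyer.BirchSwinnertonDyer.Theorems.GenusKolyvaginAtTwoMinimalTwinBSDTwoSwappedPairRationalDepth
import Summits.BirchSwinnertonDyer.BirchSwinnertonDyer.Theorems.GenusKolyvaginAtTwoMinimalTwinBSDTwoSwappedPairLocalBit
import Summits.BirchSwinnertonDyer.BirchSwinnertonDyer.Theorems.GenusKolyvaginAtTwoMinimalTwinBSDTwoIdentityDoorCellsExp
import HarnessLib

/-!
# Route `GenusKolyvaginAtTwo`, crux U₂ `MinimalTwinBSDTwo` (stmt-BirchSwinnertonDyer-22985), LINE 23 «twin_swap» v2.5: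
# THE IDENTITY DOOR'S LOCAL BIT — and LINE 23's halves DIV′ / NDIV′ at an identity-door frame, read on the rational Heegner point

Width seat `bsd-line-gk2-p4` g37 (cell `bsd-f1-sign2`), `--supports stmt-BirchSwinnertonDyer-22985` (helper; closes nothing).
THEOREMS ONLY (no definition, no named fact, no `sorry`); standard axioms; UNCONDITIONAL (rank `1` enters §4 as a binder).
**BSD is NOT proved by any of this; U₂ / hTw / DIV′ / NDIV′ are NOT proved; nothing is closed.**
Third instalment of g26's I1-swap `…SwappedPairLocalBit` (transposition prime `…_negDisc`, real place `…_posDisc`) on gk2-p2 g26's IDENTITY-PRIME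
door `…IdentityDoor` (`#Sel₂(W^{(−ℓ)}) = 1` on the `Δ > 0` identity locus at an identity prime `ℓ` with `loc_ℓ` injective on `Sel₂^{rel ∞}(W)`) and
gk2-p3 g33's `Ш`-count there (`#Ш(W_K)[2^∞] = 4`, `…IdentityDoorCellsExp`, so BSD predicts depth EXACTLY `e + 1`, `e = ord₂ c + ord₂ C(W)`); uses
this seat's all-depth reading `…SwappedPairRationalDepth` (`2^M ∣ P(1)` in `E(K[1])` ⟺ `2^M ∣ Y` in `E(ℚ)`).

* §3 **`exists_two_smul_completion_iff_kummer_eq_zero_of_injective`** — if `loc_ℓ` is injective on `Sel₂^{rel ∞}(W)` (the door's Čebotarev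
  condition on `ℓ`, binder VERBATIM from `…IdentityDoor`), then for EVERY `Y ∈ E(ℚ)`: **`Y ∈ 2E(ℚ_ℓ) ⟺ κ₂(Y) = 0`** (`κ₂(Y) ∈ Sel₂(W) ≤ Sel₂^{rel ∞}(W)`);
  **`not_two_dvd_derivedPoint_iff_localBit_identityDoor`** — on the identity-door frame (`Δ > 0`, identity locus, `#Sel₂(W) = 2`, `r_an = 1`,
  `d_K = −ℓ`, `2` split, `ℓ` identity prime with injective `loc_ℓ`): **`P(1) ∉ 2E(K[1]) ⟺ Y ∉ 2E(ℚ_ℓ)`** — the third local bit;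
  **`exactDepth_one_derivedPoint_iff_localBits_identityDoor`** — EXP_id at `e = 0` («`2 ∥ P(1)`», the identity door's one-bit-deeper law when `c`,
  `C(W)` are odd) ⟺ **«`Y ∈ 2E(ℚ_ℓ)` and no half `Y₁ ∈ E(ℚ)` of `Y` lies in `2E(ℚ_ℓ)`»** — two successive local halvings at the door prime.
* §4 `heegnerIndexHalves_frame_iff_of_identityDoor` — with `#Ш(W_K)[2^∞] = 4` the frame conclusions of DIV′ `HeegnerIndexUpperAnyTwinAtTwo` /
  NDIV′ `HeegnerIndexLowerAnyTwinAtTwo` at an exact depth `M₀` are the thresholds **`e + 1 ≤ M₀`** / **`M₀ ≤ e + 1`**;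
  ★ **`heegnerIndexHalves_frame_iff_rat_of_identityDoor`** — hence, on the rational Heegner point: **DIV′ there ⟺ `Y ∈ 2^{e+1} E(ℚ)`** (Kolyvagin's
  direction: the capitulation `Ш(W_K)[2] = (ℤ/2)²` costs one extra halving of `y_K` inside `E(ℚ)`) and **NDIV′ there ⟺ `Y ∉ 2^{e+2} E(ℚ)`**
  (the non-vanishing direction).  Per frame; the ∀-stubs themselves are untouched.

References: [GrossLMS1991] §5 Prop. 5.3; [McCallumLMS1991] §5 Lemma 5.1; [MazurRubin2010] Def. 3.1, Lemmas 2.9–2.11, Prop. 3.3; [Kramer1981] Prop. 6,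
Thm. 1, Thm. 2; [GrossZagier1986] V.§2 (2.2); [SilvermanAEC2009] VIII §2, X §4.
-/

set_option autoImplicit false
set_option linter.dupNamespace false -- `Summit.<P>.<Sub>` repeats `BirchSwinnertonDyer` (D-0017)

noncomputable section

open scoped Classical NumberField

namespace Summit.BirchSwinnertonDyer.BirchSwinnertonDyer.Theorems.GenusExact.TwinSwapBit

open IsDedekindDomain Field NumberField WeierstrassCurve Literature.NumberTheory.EllipticCurves
  Literature.NumberTheory.EllipticCurves.ModularForms Literature.NumberTheory.GaloisRepresentations Rat.HeightOneSpectrum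
open Summit.BirchSwinnertonDyer.BirchSwinnertonDyer.Theorems.GenusExact.PlusDescent
open Summit.BirchSwinnertonDyer.BirchSwinnertonDyer.Theorems.GenusExact.TwinSwap
open Summit.BirchSwinnertonDyer.BirchSwinnertonDyer.Theorems.GenusKolyArch (hdiv_two localization_kummerMapTorsion_eq_zero_iff)
open Summit.BirchSwinnertonDyer.BirchSwinnertonDyer.Theorems.GenusKolyTwistLocal (mem_torsionLocalKer_iff_localization_eq_zero_rat)
open Summit.BirchSwinnertonDyer.BirchSwinnertonDyer.Theorems.GenusExact.TwinSwap.IdentityDoor (natCard_selmerGroup_twin_eq_one_of_identityDoor)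
open Summit.BirchSwinnertonDyer.BirchSwinnertonDyer.Theorems.GenusExact.TwinSwap.IdentityDoorSha (natCard_selmerGroup_baseChange_eq_eight_and_sha_of_identityDoor)
open Summit.BirchSwinnertonDyer.Rank1Residual.F1Sign2 (selmerGroupRelaxedAtInfinityAtTwo selmerGroup_le_selmerGroupRelaxedAtInfinityAtTwo MeetsEgg)

variable (W : WeierstrassCurve ℚ) [W.IsElliptic] [W.IsGloballyMinimal] {K : Type} [Field K] [NumberField K]

/-! ## §3 The identity door's local bit -/

omit [W.IsGloballyMinimal] in
/-- **`Y ∈ 2E(ℚ_ℓ) ⟺ κ₂(Y) = 0` for EVERY rational point, when `loc_ℓ` is injective on `Sel₂^{rel ∞}(W)`.**  `W/ℚ` globally minimal; `ℓ` a prime,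
`v₀` the place of `ℚ` over `ℓ`; hypothesis (the identity door's Čebotarev condition on `ℓ`, binder VERBATIM from gk2-p2 g26's `…IdentityDoor`):
no non-zero class of the ∞-relaxed `2`-Selmer group lies in the strict local kernel at `ℓ`.  Since `κ₂(Y) ∈ Sel₂(W) ≤ Sel₂^{rel ∞}(W)` and
«`loc_{v₀} κ₂(Y) = 0` ⟺ `Y ∈ 2E(ℚ_{v₀})`» (local Kummer sequence), local halvability at `ℓ` forces `κ₂(Y) = 0`.
[cite: MazurRubin2010, Def. 3.1, Prop. 3.3] [cite: SilvermanAEC2009, VIII §2, X §4] -/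
theorem exists_two_smul_completion_iff_kummer_eq_zero_of_injective {ℓ : ℕ} [Fact ℓ.Prime]
    (hinj : ∀ c ∈ selmerGroupRelaxedAtInfinityAtTwo W, c ∈ MazurRubin2010.strictLocalKer W ℚ_[ℓ] 2 → c = 0)
    {v₀ : HeightOneSpectrum (𝓞 ℚ)} (hv₀ : ((primesEquiv v₀ : Nat.Primes) : ℕ) = ℓ) (Y : W.toAffine.Point) :
    (∃ R : (W.baseChange (Place.Completion (Sum.inr v₀ : Place ℚ))).toAffine.Point,
        ((2 : ℕ) : ℤ) • R = Affine.Point.baseChange (W' := W) ℚ (Place.Completion (Sum.inr v₀ : Place ℚ)) Y) ↔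
      kummerMapTorsion W ((2 : ℕ) : ℤ) (hdiv_two W) Y = 0 := by
  have h20 : ((2 : ℕ) : ℤ) ≠ 0 := by norm_num
  refine ⟨fun hloc ↦ ?_, fun h0 ↦ ?_⟩
  swap
  · exact (localization_kummerMapTorsion_eq_zero_iff W h20 (hdiv_two W) (Sum.inr v₀) Y).mp
      (by rw [h0]; exact AddMonoidHom.map_zero _)
  -- the Kummer class of `Y` lies in `Sel₂(W) ≤ Sel₂^{rel ∞}(W)` and localises to `0` at `v₀`
  set c := kummerMapTorsion W ((2 : ℕ) : ℤ) (hdiv_two W) Y with hc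
  have hcS : c ∈ selmerGroupRelaxedAtInfinityAtTwo W :=
    selmerGroup_le_selmerGroupRelaxedAtInfinityAtTwo W (kummerMapTorsion_mem_selmerGroup W _ (hdiv_two W) Y)
  have h0 : galoisCohomology.localization (W.torsionGaloisModule ((2 : ℕ) : ℤ)) (Sum.inr v₀) 1 c = 0 :=
    (localization_kummerMapTorsion_eq_zero_iff W h20 (hdiv_two W) (Sum.inr v₀) Y).mpr hloc
  refine hinj c hcS ?_
  have h1 : c ∈ W.torsionLocalKer (v₀.adicCompletion ℚ) ((2 : ℕ) : ℤ) :=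
    (mem_torsionLocalKer_iff_localization_eq_zero_rat W v₀ c).mpr h0
  haveI := Fact.mk (primesEquiv v₀).2
  letI : Algebra ℚ (v₀.adicCompletion ℚ) := inferInstance
  haveI : CharZero (v₀.adicCompletion ℚ) :=
    Literature.NumberTheory.GaloisRepresentations.charZero_adicCompletion v₀
  have h2 := (GenusKolyTwistingPrime.mem_torsionLocalKer_padic_iff W
    (RingEquivClass.toRingEquiv (Rat.HeightOneSpectrum.adicCompletion.padicEquiv (R := 𝓞 ℚ) v₀)) ((2 : ℕ) : ℤ) c).mpr h1
  subst hv₀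
  exact h2

/-- **I1-swap at the IDENTITY door: «`P(1) ∉ 2E(K[1])`» ⟺ «the rational Heegner point is NOT halvable in `E(ℚ_ℓ)`».**  The frame of gk2-p2
g26's identity door (`…IdentityDoor.natCard_selmerGroup_twin_eq_one_of_identityDoor`, binders VERBATIM): `W/ℚ` globally minimal, `Δ_W > 0`,
`#Sel₂(W) = 2` with its class trivial at `∞` (identity locus), analytic rank `1`; `K = ℚ(√−ℓ)`, `d_K = −ℓ` odd, Heegner for `N_W`, `2` split;
`ℓ` an IDENTITY prime (`#W(ℚ_ℓ)[2] = 4`) at which `loc_ℓ` is injective on `Sel₂^{rel ∞}(W)`; `Dt`, `(β, ι)`, a conductor-`1` datum `d₁` with `P(1)`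
of infinite order.  THEN (the door gives `#Sel₂(W^{(d_K)}) = 1`, so `E(ℚ)[2] = 0`, g26's frame) for `P₀ ∈ E(K)` over `P(1)` and the RATIONAL
`Y ∈ E(ℚ)` with `ι Y − P₀ ∈ 2·E(K)_tors`: **`P(1) ∉ 2E(K[1]) ⟺ Y ∉ 2E(ℚ_ℓ)`** (`ℚ_ℓ` = the completion at the place `v₀ ∋ ℓ`).  The third local bit
after the transposition prime (`Δ < 0`) and the real place (all-silent, `Δ > 0`).  Unconditional; credits nothing by itself.
[cite: GrossLMS1991, §5 Prop. 5.3] [cite: McCallumLMS1991, §5 Lemma 5.1] [cite: MazurRubin2010, Lemmas 2.9–2.11, Prop. 3.3] [cite: Kramer1981, Prop. 6, Thm. 1] -/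
theorem not_two_dvd_derivedPoint_iff_localBit_identityDoor [NeZero (W.conductorNorm ℤ)]
    (hr : W.analyticRank = 1) (hΔ : 0 < W.Δ) (hSel : Nat.card (W.selmerGroup 2) = 2)
    (hK : IsImaginaryQuadratic K) (hodd : Odd (NumberField.discr K)) (hH : SatisfiesHeegnerHypothesis (W.conductorNorm ℤ) K)
    (h2K : ((Ideal.span {(2 : ℤ)}).primesOver (𝓞 K)).ncard = 2)
    {ℓ : ℕ} [Fact ℓ.Prime] (hd : NumberField.discr K = -(ℓ : ℤ))
    (hid : Nat.card {Q : (W.baseChange ℚ_[ℓ]).toAffine.Point // 2 • Q = 0} = 4)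
    (hstr : ∀ c ∈ (W.kummerSelmerStructure ((2 : ℕ) : ℤ)).selmerGroup,
      galoisCohomology.localization (W.torsionGaloisModule ((2 : ℕ) : ℤ)) (Sum.inl Rat.infinitePlace) 1 c = 0)
    (hinj : ∀ c ∈ selmerGroupRelaxedAtInfinityAtTwo W, c ∈ MazurRubin2010.strictLocalKer W ℚ_[ℓ] 2 → c = 0)
    (Dt : ModularParametrizationData W (W.conductorNorm ℤ)) (β : ℤ) (ι : K →+* ℂ) (d₁ : KolyvaginHeegnerData Dt β ι 1)
    (hy : ¬ IsOfFinAddOrder d₁.derivedPoint) :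
    ∃ v₀ : HeightOneSpectrum (𝓞 ℚ), ((primesEquiv v₀ : Nat.Primes) : ℕ) = ℓ ∧
      ∃ (P₀ : (W.baseChange K).toAffine.Point) (Y : W.toAffine.Point) (u : (W.baseChange K).toAffine.Point),
        Affine.Point.map (W' := W) (algebraMap K (ringClassField K ι 1)).toRatAlgHom P₀ = d₁.derivedPoint ∧
        IsOfFinAddOrder u ∧ QuadraticDescent.incl K W Y = P₀ + (2 : ℤ) • u ∧
        ((¬ ∃ Q : (W.baseChange (ringClassField K ι 1)).toAffine.Point, (2 : ℤ) • Q = d₁.derivedPoint) ↔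
          ¬ ∃ R : (W.baseChange (Place.Completion (Sum.inr v₀ : Place ℚ))).toAffine.Point,
            ((2 : ℕ) : ℤ) • R = Affine.Point.baseChange (W' := W) ℚ (Place.Completion (Sum.inr v₀ : Place ℚ)) Y) := by
  -- the door: the twist itself is a `2`-Selmer-trivial model of `W^{(d_K)}`
  have hd0 : (NumberField.discr K : ℚ) ≠ 0 := by exact_mod_cast (IsImaginaryQuadratic.discr_neg hK).ne
  haveI := W.isElliptic_quadraticTwist hd0
  have hSel1 : Nat.card ((W.quadraticTwist (NumberField.discr K : ℚ)).selmerGroup 2) = 1 :=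
    natCard_selmerGroup_twin_eq_one_of_identityDoor W hΔ hSel hK hodd hH h2K hd hid hstr hinj
      (W.quadraticTwist (NumberField.discr K : ℚ)) ⟨1, one_smul _ _⟩
  obtain ⟨v₀, hv₀⟩ : ∃ v : HeightOneSpectrum (𝓞 ℚ), ((primesEquiv v : Nat.Primes) : ℕ) = ℓ :=
    ⟨primesEquiv.symm ⟨ℓ, Fact.out⟩, by rw [Equiv.apply_symm_apply]⟩
  have hw : W.rootNumber = -1 := rootNumber_eq_neg_one_of_analyticRank_eq_one W hr Dt
  have hT2 := noTwoTorsion_of_frame W hSel hK hH Dt β ι d₁ hy 1 (one_smul _ _) hSel1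
  have h2K' : ∀ x : (W.baseChange K).toAffine.Point, (2 : ℤ) • x = 0 → x = 0 := fun x hx ↦
    forall_two_zsmul_baseChange_eq_zero_of_heegner W K hK hodd hH hT2 x hx
  obtain ⟨P₀, Y, u, hP₀, hu, hY⟩ := exists_rational_heegnerPoint_of_rootNumber_eq_neg_one W hK hH hw h2K' Dt β ι d₁
  refine ⟨v₀, hv₀, P₀, Y, u, hP₀, hu, hY, not_congr ?_⟩
  rw [exists_two_smul_derivedPoint_iff_kummer_eq_zero W hK hodd hH hT2 Dt β ι d₁ hP₀ hY,
    exists_two_smul_completion_iff_kummer_eq_zero_of_injective W hinj hv₀ Y]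

/-- **EXP_id at `e = 0` in local currency: «`2 ∥ P(1)`» ⟺ two successive local halvings at the door prime.**  Same identity-door frame as
`not_two_dvd_derivedPoint_iff_localBit_identityDoor`.  For the rational Heegner point `Y`: **`2 ∣ P(1)` and `4 ∤ P(1)` in `E(K[1])` ⟺
`Y ∈ 2E(ℚ_ℓ)` and NO `Y₁ ∈ E(ℚ)` with `2Y₁ = Y` lies in `2E(ℚ_ℓ)`** (when `c` and `C(W)` are odd this is exactly the identity locus' exponent stub
EXP_id «`2^{ord₂ c + ord₂ C(W) + 1} ∥ P(1)`» of `…IdentityDoorCellsExp`, i.e. KEX′ with `#Ш(W_K)[2^∞] = 4`; in general EXP_id needs `e + 1` halvings,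
each read by `exists_two_smul_completion_iff_kummer_eq_zero_of_injective` on the successive rational halves, §2).  Unconditional; credits nothing.
[cite: McCallumLMS1991, §5 Lemma 5.1] [cite: MazurRubin2010, Prop. 3.3] [cite: Kramer1981, Thm. 1] -/
theorem exactDepth_one_derivedPoint_iff_localBits_identityDoor [NeZero (W.conductorNorm ℤ)]
    (hr : W.analyticRank = 1) (hΔ : 0 < W.Δ) (hSel : Nat.card (W.selmerGroup 2) = 2)
    (hK : IsImaginaryQuadratic K) (hodd : Odd (NumberField.discr K)) (hH : SatisfiesHeegnerHypothesis (W.conductorNorm ℤ) K)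
    (h2K : ((Ideal.span {(2 : ℤ)}).primesOver (𝓞 K)).ncard = 2)
    {ℓ : ℕ} [Fact ℓ.Prime] (hd : NumberField.discr K = -(ℓ : ℤ))
    (hid : Nat.card {Q : (W.baseChange ℚ_[ℓ]).toAffine.Point // 2 • Q = 0} = 4)
    (hstr : ∀ c ∈ (W.kummerSelmerStructure ((2 : ℕ) : ℤ)).selmerGroup,
      galoisCohomology.localization (W.torsionGaloisModule ((2 : ℕ) : ℤ)) (Sum.inl Rat.infinitePlace) 1 c = 0)
    (hinj : ∀ c ∈ selmerGroupRelaxedAtInfinityAtTwo W, c ∈ MazurRubin2010.strictLocalKer W ℚ_[ℓ] 2 → c = 0)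
    (Dt : ModularParametrizationData W (W.conductorNorm ℤ)) (β : ℤ) (ι : K →+* ℂ) (d₁ : KolyvaginHeegnerData Dt β ι 1)
    (hy : ¬ IsOfFinAddOrder d₁.derivedPoint) :
    ∃ v₀ : HeightOneSpectrum (𝓞 ℚ), ((primesEquiv v₀ : Nat.Primes) : ℕ) = ℓ ∧
      ∃ (P₀ : (W.baseChange K).toAffine.Point) (Y : W.toAffine.Point) (u : (W.baseChange K).toAffine.Point),
        Affine.Point.map (W' := W) (algebraMap K (ringClassField K ι 1)).toRatAlgHom P₀ = d₁.derivedPoint ∧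
        IsOfFinAddOrder u ∧ QuadraticDescent.incl K W Y = P₀ + (2 : ℤ) • u ∧
        (((∃ Q : (W.baseChange (ringClassField K ι 1)).toAffine.Point, ((2 ^ 1 : ℕ) : ℤ) • Q = d₁.derivedPoint) ∧
            ¬ ∃ Q : (W.baseChange (ringClassField K ι 1)).toAffine.Point, ((2 ^ (1 + 1) : ℕ) : ℤ) • Q = d₁.derivedPoint) ↔
          ((∃ R : (W.baseChange (Place.Completion (Sum.inr v₀ : Place ℚ))).toAffine.Point,
              ((2 : ℕ) : ℤ) • R = Affine.Point.baseChange (W' := W) ℚ (Place.Completion (Sum.inr v₀ : Place ℚ)) Y) ∧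
            ∀ Y₁ : W.toAffine.Point, (2 : ℤ) • Y₁ = Y →
              ¬ ∃ R : (W.baseChange (Place.Completion (Sum.inr v₀ : Place ℚ))).toAffine.Point,
                ((2 : ℕ) : ℤ) • R = Affine.Point.baseChange (W' := W) ℚ (Place.Completion (Sum.inr v₀ : Place ℚ)) Y₁)) := by
  -- the door: the twist itself is a `2`-Selmer-trivial model of `W^{(d_K)}`; `E(ℚ)[2] = 0`
  have hd0 : (NumberField.discr K : ℚ) ≠ 0 := by exact_mod_cast (IsImaginaryQuadratic.discr_neg hK).ne
  haveI := W.isElliptic_quadraticTwist hd0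
  have hSel1 : Nat.card ((W.quadraticTwist (NumberField.discr K : ℚ)).selmerGroup 2) = 1 :=
    natCard_selmerGroup_twin_eq_one_of_identityDoor W hΔ hSel hK hodd hH h2K hd hid hstr hinj
      (W.quadraticTwist (NumberField.discr K : ℚ)) ⟨1, one_smul _ _⟩
  obtain ⟨v₀, hv₀⟩ : ∃ v : HeightOneSpectrum (𝓞 ℚ), ((primesEquiv v : Nat.Primes) : ℕ) = ℓ :=
    ⟨primesEquiv.symm ⟨ℓ, Fact.out⟩, by rw [Equiv.apply_symm_apply]⟩
  have hT2 := noTwoTorsion_of_frame W hSel hK hH Dt β ι d₁ hy 1 (one_smul _ _) hSel1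
  obtain ⟨P₀, Y, u, hP₀, hu, hY, hall⟩ :=
    exists_rational_heegnerPoint_forall_two_pow_smul_iff W hr hT2 hK hodd hH Dt β ι d₁
  have hloc := exists_two_smul_completion_iff_kummer_eq_zero_of_injective W hinj hv₀
  have hκ : ∀ Z : W.toAffine.Point,
      kummerMapTorsion W ((2 : ℕ) : ℤ) (hdiv_two W) Z = 0 ↔ ∃ Q₀ : W.toAffine.Point, (2 : ℤ) • Q₀ = Z := by
    intro Z
    have h := kummerMapTorsion_eq_zero_iff_exists_smul_dec W (hdiv_two W) Z
    simp only [Nat.cast_ofNat] at h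
    exact h
  -- depth `2`: `4 ∣ P(1) ⟺ 4 ∣ Y ⟺` some half `Y₁ ∈ E(ℚ)` of `Y` lies in `2E(ℚ) ⟺` in `2E(ℚ_ℓ)`
  have hB : (∃ Q : (W.baseChange (ringClassField K ι 1)).toAffine.Point, ((2 ^ (1 + 1) : ℕ) : ℤ) • Q = d₁.derivedPoint) ↔
      ∃ Y₁ : W.toAffine.Point, (2 : ℤ) • Y₁ = Y ∧
        ∃ R : (W.baseChange (Place.Completion (Sum.inr v₀ : Place ℚ))).toAffine.Point,
          ((2 : ℕ) : ℤ) • R = Affine.Point.baseChange (W' := W) ℚ (Place.Completion (Sum.inr v₀ : Place ℚ)) Y₁ := by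
    rw [hall (1 + 1)]
    constructor
    · rintro ⟨Q₀, hQ₀⟩
      refine ⟨(2 : ℤ) • Q₀, ?_, (hloc _).mpr ((hκ _).mpr ⟨Q₀, rfl⟩)⟩
      rw [smul_smul, ← hQ₀]
      norm_num
    · rintro ⟨Y₁, hY₁, hR⟩
      obtain ⟨Q₀, hQ₀⟩ := (hκ Y₁).mp ((hloc Y₁).mp hR)
      refine ⟨Q₀, ?_⟩
      rw [← hY₁, ← hQ₀, smul_smul]
      norm_num
  refine ⟨v₀, hv₀, P₀, Y, u, hP₀, hu, hY, and_congr ?_ ?_⟩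
  · -- depth `1`: `2 ∣ P(1) ⟺ 2 ∣ Y ⟺ κ₂(Y) = 0 ⟺ Y ∈ 2E(ℚ_ℓ)`
    rw [hall 1, hloc Y, hκ Y]
    simp only [pow_one, Nat.cast_ofNat]
  · rw [hB]
    simp only [not_exists, not_and]


/-! ## §4 LINE 23 v2.5's halves DIV′ / NDIV′ at an identity-door frame: thresholds `e + 1` on the `2`-depth of `Y` in `E(ℚ)` -/

/-- `2^b ∣ Y ⟹ 2^a ∣ Y` for `a ≤ b`. [folklore] -/
private theorem exists_two_pow_zsmul_of_le {A : Type*} [AddCommGroup A] {Y : A} {a b : ℕ} (hab : a ≤ b)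
    (h : ∃ Q : A, ((2 ^ b : ℕ) : ℤ) • Q = Y) : ∃ Q : A, ((2 ^ a : ℕ) : ℤ) • Q = Y := by
  obtain ⟨Q, hQ⟩ := h
  refine ⟨((2 ^ (b - a) : ℕ) : ℤ) • Q, ?_⟩
  rw [smul_smul, ← hQ]
  congr 1
  rw [← Nat.cast_mul, ← pow_add]
  congr 2
  omega

/-- **DIV′ / NDIV′ at an identity-door frame are the thresholds `e + 1 ≤ M₀` / `M₀ ≤ e + 1`** (`e = ord₂ c + ord₂ C(W)`).  The frame of gk2-p2 g26's
identity door in the finiteness-free form of `…IdentityDoorCellsExp` (binders VERBATIM): `W/ℚ` globally minimal, `Δ_W > 0`, rank `1`, `#Sel₂(W) = 2`,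
off the egg; `K = ℚ(√−ℓ)`, `d_K = −ℓ` odd, Heegner, `2` split; `ℓ` identity prime with `loc_ℓ` injective on `Sel₂^{rel ∞}(W)`.  There
`#Ш(W_K)[2^∞] = 4` (gk2-p3 g33 / `natCard_selmerGroup_baseChange_eq_eight_and_sha_of_identityDoor`), so for ANY datum `Dt` and ANY `M₀` the
conclusion of LINE 23 v2.5's DIV′ `HeegnerIndexUpperAnyTwinAtTwo` at this frame, `#Ш(W_K)[2^∞]·4^e ∣ 4^{M₀}`, reads **`e + 1 ≤ M₀`**, and that of
NDIV′ `HeegnerIndexLowerAnyTwinAtTwo`, `4^{M₀} ∣ #Ш(W_K)[2^∞]·4^e`, reads **`M₀ ≤ e + 1`**.  Unconditional (rank `1` is a binder); closes nothing.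
[cite: Kramer1981, Thm. 1, Thm. 2] [cite: GrossZagier1986, V.§2 (2.2)] [cite: McCallumLMS1991, §5 Lemma 5.1] -/
theorem heegnerIndexHalves_frame_iff_of_identityDoor [NeZero (W.conductorNorm ℤ)] (hΔ : 0 < W.Δ) (hrk : W.mordellWeilRank = 1)
    (hSel : Nat.card (W.selmerGroup 2) = 2) (hegg : ¬ MeetsEgg W)
    (hK : IsImaginaryQuadratic K) (hodd : Odd (NumberField.discr K)) (hH : SatisfiesHeegnerHypothesis (W.conductorNorm ℤ) K)
    (h2K : ((Ideal.span {(2 : ℤ)}).primesOver (𝓞 K)).ncard = 2)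
    {ℓ : ℕ} [Fact ℓ.Prime] (hd : NumberField.discr K = -(ℓ : ℤ))
    (hid : Nat.card {Q : (W.baseChange ℚ_[ℓ]).toAffine.Point // 2 • Q = 0} = 4)
    (hinj : ∀ c ∈ selmerGroupRelaxedAtInfinityAtTwo W, c ∈ MazurRubin2010.strictLocalKer W ℚ_[ℓ] 2 → c = 0)
    (Dt : ModularParametrizationData W (W.conductorNorm ℤ)) (M₀ : ℕ) :
    (Nat.card (AddCommGroup.primaryComponent (W.baseChange K).sha 2) *
          2 ^ (2 * (padicValInt 2 Dt.c + padicValNat 2 W.tamagawaProduct)) ∣ 2 ^ (2 * M₀) ↔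
        padicValInt 2 Dt.c + padicValNat 2 W.tamagawaProduct + 1 ≤ M₀) ∧
      (2 ^ (2 * M₀) ∣ Nat.card (AddCommGroup.primaryComponent (W.baseChange K).sha 2) *
          2 ^ (2 * (padicValInt 2 Dt.c + padicValNat 2 W.tamagawaProduct)) ↔
        M₀ ≤ padicValInt 2 Dt.c + padicValNat 2 W.tamagawaProduct + 1) := by
  obtain ⟨-, -, -, h4⟩ :=
    natCard_selmerGroup_baseChange_eq_eight_and_sha_of_identityDoor W K hΔ hrk hSel hegg hK hodd hH h2K hd hid hinj
  rw [h4]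
  have h4e : 4 * 2 ^ (2 * (padicValInt 2 Dt.c + padicValNat 2 W.tamagawaProduct)) =
      2 ^ (2 * (padicValInt 2 Dt.c + padicValNat 2 W.tamagawaProduct + 1)) := by ring
  rw [h4e, Nat.pow_dvd_pow_iff_le_right one_lt_two, Nat.pow_dvd_pow_iff_le_right one_lt_two]
  omega

/-- ★ **At an identity-door frame, DIV′ ⟺ `Y ∈ 2^{e+1} E(ℚ)` and NDIV′ ⟺ `Y ∉ 2^{e+2} E(ℚ)`** for the rational Heegner point `Y` (§2), `e = ord₂ c +
ord₂ C(W)`.  Same frame as `heegnerIndexHalves_frame_iff_of_identityDoor`, plus a conductor-`1` datum `d₁`, `P₀ ∈ E(K)` over `P(1)`, `Y ∈ E(ℚ)` and a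
torsion `u` with `ι Y = P₀ + 2u`, and an exact depth `2^{M₀} ∥ P(1)`.  Then `M₀` is the exact `2`-depth of `Y` in `E(ℚ)` (§2; `E(ℚ)[2] = 0` from
`#Sel₂ = 2` at rank `1`), and the thresholds of the previous theorem become divisibilities of `Y`: the Kolyvagin-direction half DIV′ is «the
capitulation `Ш(W_K)[2] = (ℤ/2)²` costs one extra halving of the Heegner point IN `E(ℚ)`», the non-vanishing half NDIV′ is «and no more».
Unconditional (rank `1` is a binder); the ∀-stubs DIV′ / NDIV′ themselves are untouched; BSD is not proved.
[cite: McCallumLMS1991, §5 Lemma 5.1] [cite: GrossLMS1991, §5 Prop. 5.3] [cite: Kramer1981, Thm. 1, Thm. 2] -/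
theorem heegnerIndexHalves_frame_iff_rat_of_identityDoor [NeZero (W.conductorNorm ℤ)] (hΔ : 0 < W.Δ) (hrk : W.mordellWeilRank = 1)
    (hSel : Nat.card (W.selmerGroup 2) = 2) (hegg : ¬ MeetsEgg W)
    (hK : IsImaginaryQuadratic K) (hodd : Odd (NumberField.discr K)) (hH : SatisfiesHeegnerHypothesis (W.conductorNorm ℤ) K)
    (h2K : ((Ideal.span {(2 : ℤ)}).primesOver (𝓞 K)).ncard = 2)
    {ℓ : ℕ} [Fact ℓ.Prime] (hd : NumberField.discr K = -(ℓ : ℤ))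
    (hid : Nat.card {Q : (W.baseChange ℚ_[ℓ]).toAffine.Point // 2 • Q = 0} = 4)
    (hinj : ∀ c ∈ selmerGroupRelaxedAtInfinityAtTwo W, c ∈ MazurRubin2010.strictLocalKer W ℚ_[ℓ] 2 → c = 0)
    (Dt : ModularParametrizationData W (W.conductorNorm ℤ)) (β : ℤ) (ι : K →+* ℂ) (d₁ : KolyvaginHeegnerData Dt β ι 1)
    {P₀ : (W.baseChange K).toAffine.Point} {Y : W.toAffine.Point} {u : (W.baseChange K).toAffine.Point}
    (hP₀ : Affine.Point.map (W' := W) (algebraMap K (ringClassField K ι 1)).toRatAlgHom P₀ = d₁.derivedPoint)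
    (hu : IsOfFinAddOrder u) (hY : QuadraticDescent.incl K W Y = P₀ + (2 : ℤ) • u) {M₀ : ℕ}
    (hdiv : ∃ Q : (W.baseChange (ringClassField K ι 1)).toAffine.Point, ((2 ^ M₀ : ℕ) : ℤ) • Q = d₁.derivedPoint)
    (hndiv : ¬ ∃ Q : (W.baseChange (ringClassField K ι 1)).toAffine.Point, ((2 ^ (M₀ + 1) : ℕ) : ℤ) • Q = d₁.derivedPoint) :
    (Nat.card (AddCommGroup.primaryComponent (W.baseChange K).sha 2) *
          2 ^ (2 * (padicValInt 2 Dt.c + padicValNat 2 W.tamagawaProduct)) ∣ 2 ^ (2 * M₀) ↔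
        ∃ Q₀ : W.toAffine.Point, ((2 ^ (padicValInt 2 Dt.c + padicValNat 2 W.tamagawaProduct + 1) : ℕ) : ℤ) • Q₀ = Y) ∧
      (2 ^ (2 * M₀) ∣ Nat.card (AddCommGroup.primaryComponent (W.baseChange K).sha 2) *
          2 ^ (2 * (padicValInt 2 Dt.c + padicValNat 2 W.tamagawaProduct)) ↔
        ¬ ∃ Q₀ : W.toAffine.Point, ((2 ^ (padicValInt 2 Dt.c + padicValNat 2 W.tamagawaProduct + 2) : ℕ) : ℤ) • Q₀ = Y) := by
  obtain ⟨hU, hL⟩ := heegnerIndexHalves_frame_iff_of_identityDoor W hΔ hrk hSel hegg hK hodd hH h2K hd hid hinj Dt M₀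
  -- `E(ℚ)[2] = 0`; the exact `2`-depth of `Y` in `E(ℚ)` is `M₀` (§2)
  obtain ⟨-, hT2', -⟩ := rank_eq_one_and_sha_primary_eq_zero_of_natCard_selmerGroup_eq_two W hSel (le_of_eq hrk.symm)
  have hT2 : ∀ P : W.toAffine.Point, 2 • P = 0 → P = 0 := fun P hP ↦ by convert hT2' P (by convert hP)
  have hall := fun M ↦ exists_two_pow_smul_derivedPoint_iff W hK hodd hH hT2 Dt β ι d₁ hP₀ hu hY M
  have hdivY : ∃ Q₀ : W.toAffine.Point, ((2 ^ M₀ : ℕ) : ℤ) • Q₀ = Y := (hall M₀).mp hdiv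
  have hndivY : ¬ ∃ Q₀ : W.toAffine.Point, ((2 ^ (M₀ + 1) : ℕ) : ℤ) • Q₀ = Y := fun h ↦ hndiv ((hall (M₀ + 1)).mpr h)
  set e := padicValInt 2 Dt.c + padicValNat 2 W.tamagawaProduct with he
  constructor
  · rw [hU]
    constructor
    · exact fun hle ↦ exists_two_pow_zsmul_of_le hle hdivY
    · intro h
      by_contra hlt
      exact hndivY (exists_two_pow_zsmul_of_le (by omega) h)
  · rw [hL]
    constructor
    · exact fun hle h ↦ hndivY (exists_two_pow_zsmul_of_le (by omega) h)
    · intro h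
      by_contra hlt
      exact h (exists_two_pow_zsmul_of_le (by omega) hdivY)

end Summit.BirchSwinnertonDyer.BirchSwinnertonDyer.Theorems.GenusExact.TwinSwapBit

end
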